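import Summits.CriticalPhenomena.PercolationContinuityZ3.Theorems.PercNearOneGluingNoHeavyQuantPoissonBinomialRatio
import Summits.CriticalPhenomena.PercolationContinuityZ3.Theorems.PercNearOneGluingNoHeavyQuantTwoLevelTopBlock
import HarnessLib

/-!
# QUANT lane R8, FAR on trees: the two-level inequality for a LIGHT block (`a ≤ j`, every layer) —
# the loose-hub-plus-block family beyond its tight direction

builds on p205010 (kernel theorem, internal audit signed; external expert review pending)

Support file (`--supports stmt-CriticalPhenomena-4575`), QUANT lane typer seat prim-quant-stmt (gen 10); memo
`run/shared/lean/prim/quant/prim-quant-stmt-g10/TLB-NOTES.md` §5–§7; companions `…QuantTwoLevelTopBlock.lean` (the case `a = j`),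
`…QuantPoissonBinomialRatio.lean` (`Quant.pb_tail_le_atom`, the anti-concentration input).  Theorems only; no sorries; standard axioms.

Setting as in `…QuantTwoLevelTopBlock.lean`: `X = c + #{open leaves}` under `prodBernoulli p` on `Set ι` (leaf gates `p i ≥ u > 0`), a block of
`a` relays (`1 ≤ a ≤ j`) with gate `g`, hub gate `G`.  With `k := j − a`:

* `Quant.count_le_threeWindow_bound` — pointwise: `X ≤ k·1[1 ≤ X ≤ k] + j·1[k+1 ≤ X ≤ j] + (c + |ι|)·1[X ≥ j+1]`.
* `Quant.twoLevel_lightBlock` — **TLB for every light block**: if `2k + 1 ≤ c + Σ p_i` and `(g/u)(c + Σ p_i) + a·g > 2j` then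
  `u ≤ P(X ≥ j+1) + g·P(j+1−a ≤ X ≤ j)`.  Proof: integrate the pointwise bound (`E X = c + Σ p_i`), bound `P(1 ≤ X ≤ k) ≤ P(X ≤ k) ≤ P(X = k+1)
  ≤ P(k+1 ≤ X ≤ j)` by THE ATOM BEATS THE TAIL (`Quant.pb_tail_le_atom`, mean `≥ 2k+1`), use the star row `P(X ≤ k) ≤ 1 − u`
  (`Quant.halfMean_smallBall`, mean `> 2k`) and `(c + Σ p_i)/u ≥ c + |ι|`; this gives `V·A + 2j·B ≥ u·V` with `V = (c + Σ p_i)/u + a`,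
  `A = P(X ≥ j+1)`, `B = P(j+1−a ≤ X ≤ j)`, and `g·V > 2j` finishes.
* `Quant.twoLevel_lightBlock_tree` — tree form: under the FAR mean hypothesis `2j < G·(c + Σ p_i) + a·g` (`0 < G ≤ 1`, `0 < g ≤ 1`),
  `G·(A + g·B) ≥ min(g, G·p i₀)` for a least reliable leaf `i₀` (the extra hypothesis `2k+1 ≤ c + Σ p_i` is automatic here).
[cite: KozmaNitzan2024, Conjecture 3 (p. 15)] (the gluing rows served); the inequalities are [this work].
-/

noncomputable section

namespace Summit.CriticalPhenomena.PercolationContinuityZ3.Theorems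

open MeasureTheory Finset
open Literature.Probability.LatticeModels
open Literature.Probability.Percolation
open Literature.Probability.Percolation.BHK2006 (weight weight_nonneg)
open Literature.Probability.Percolation.DecisionTree (ind ind_of_mem ind_of_not_mem ind_nonneg)
open scoped Classical

namespace Quant

variable {ι : Type*} [Fintype ι]

/-- Pointwise three-window bound: with `X = c + #s`, `M = c + |ι|` and `k ≤ j`:
`X ≤ k·1[1 ≤ X ≤ k] + j·1[k+1 ≤ X ≤ j] + M·1[j+1 ≤ X]` (any `k`, `j`). [folklore] -/
theorem count_le_threeWindow_bound (c k j : ℕ) (s : Set ι) :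
    ((c + (univ.filter (fun i => i ∈ s)).card : ℕ) : ℝ) ≤
      (k : ℝ) * ind {s' : Set ι | 1 ≤ c + (univ.filter (fun i => i ∈ s')).card ∧
          c + (univ.filter (fun i => i ∈ s')).card ≤ k} s +
        (j : ℝ) * ind {s' : Set ι | k + 1 ≤ c + (univ.filter (fun i => i ∈ s')).card ∧
          c + (univ.filter (fun i => i ∈ s')).card ≤ j} s +
        ((c : ℝ) + Fintype.card ι) * ind {s' : Set ι | j + 1 ≤ c + (univ.filter (fun i => i ∈ s')).card} s := by
  set X : ℕ := c + (univ.filter (fun i => i ∈ s)).card with hX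
  set E1 : Set (Set ι) := {s' : Set ι | 1 ≤ c + (univ.filter (fun i => i ∈ s')).card ∧
    c + (univ.filter (fun i => i ∈ s')).card ≤ k} with hE1
  set E2 : Set (Set ι) := {s' : Set ι | k + 1 ≤ c + (univ.filter (fun i => i ∈ s')).card ∧
    c + (univ.filter (fun i => i ∈ s')).card ≤ j} with hE2
  set E3 : Set (Set ι) := {s' : Set ι | j + 1 ≤ c + (univ.filter (fun i => i ∈ s')).card} with hE3
  have hXM : X ≤ c + Fintype.card ι := by
    have : (univ.filter (fun i => i ∈ s)).card ≤ Fintype.card ι := by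
      rw [← Finset.card_univ]; exact Finset.card_filter_le _ _
    omega
  have hk0 : (0 : ℝ) ≤ k := Nat.cast_nonneg k
  have hj0 : (0 : ℝ) ≤ j := Nat.cast_nonneg j
  have hM0 : (0 : ℝ) ≤ (c : ℝ) + Fintype.card ι := by positivity
  by_cases h3 : j + 1 ≤ X
  · rw [ind_of_mem (show s ∈ E3 from h3), mul_one]
    have hXM' : (X : ℝ) ≤ (c : ℝ) + Fintype.card ι := by exact_mod_cast hXM
    nlinarith [ind_nonneg E1 s, ind_nonneg E2 s]
  · rw [ind_of_not_mem (show s ∉ E3 from h3), mul_zero, add_zero]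
    by_cases h2 : k + 1 ≤ X
    · rw [ind_of_mem (show s ∈ E2 from ⟨h2, by show X ≤ j; omega⟩), mul_one]
      have : (X : ℝ) ≤ j := by exact_mod_cast (show X ≤ j by omega)
      nlinarith [ind_nonneg E1 s]
    · rw [ind_of_not_mem (show s ∉ E2 from fun h => h2 h.1), mul_zero, add_zero]
      by_cases h1 : 1 ≤ X
      · rw [ind_of_mem (show s ∈ E1 from ⟨h1, by show X ≤ k; omega⟩), mul_one]
        exact_mod_cast (show X ≤ k by omega)
      · rw [ind_of_not_mem (show s ∉ E1 from fun h => h1 h.1), mul_zero]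
        have : X = 0 := by omega
        rw [this, Nat.cast_zero]

/-- **The two-level inequality for a light block (`1 ≤ a ≤ j`).**  For `X = c + #{open leaves}` under `prodBernoulli p` with
`0 < u ≤ p i` (at least one leaf), a block size `a` with `1 ≤ a ≤ j`, and a real `g`: if `2(j − a) + 1 ≤ c + Σ_i p_i` and
`(g/u)·(c + Σ_i p_i) + a·g > 2j` then `u ≤ P(X ≥ j+1) + g·P(j+1−a ≤ X ≤ j)`.  The anti-concentration step is
`Quant.pb_tail_le_atom` (`P(X ≤ j−a) ≤ P(X = j−a+1)`); the star row `P(X ≤ j−a) ≤ 1 − u` is `Quant.halfMean_smallBall`. [this work] -/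
theorem twoLevel_lightBlock (p : ι → unitInterval) (c j a : ℕ) (u g : ℝ) (hu0 : 0 < u) (hup : ∀ i, u ≤ (p i : ℝ))
    (i₀ : ι) (ha1 : 1 ≤ a) (haj : a ≤ j)
    (hCU : (2 * (j - a) : ℝ) + 1 ≤ (c : ℝ) + ∑ i, (p i : ℝ))
    (hmean : (2 * j : ℝ) < g / u * ((c : ℝ) + ∑ i, (p i : ℝ)) + a * g) :
    u ≤ (prodBernoulli p).real {s : Set ι | j + 1 ≤ c + (univ.filter (fun i => i ∈ s)).card} +
      g * (prodBernoulli p).real {s : Set ι | j + 1 - a ≤ c + (univ.filter (fun i => i ∈ s)).card ∧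
        c + (univ.filter (fun i => i ∈ s)).card ≤ j} := by
  set μ := prodBernoulli p with hμ
  set k : ℕ := j - a with hk
  have hk1 : j + 1 - a = k + 1 := by omega
  rw [hk1]
  set W : Set ι → ℝ := weight (fun e => (p e : ℝ)) with hW
  set E1 : Set (Set ι) := {s' : Set ι | 1 ≤ c + (univ.filter (fun i => i ∈ s')).card ∧
    c + (univ.filter (fun i => i ∈ s')).card ≤ k} with hE1
  set E2 : Set (Set ι) := {s' : Set ι | k + 1 ≤ c + (univ.filter (fun i => i ∈ s')).card ∧
    c + (univ.filter (fun i => i ∈ s')).card ≤ j} with hE2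
  set E3 : Set (Set ι) := {s' : Set ι | j + 1 ≤ c + (univ.filter (fun i => i ∈ s')).card} with hE3
  set S : ℝ := (c : ℝ) + ∑ i, (p i : ℝ) with hS
  have hp0 : ∀ i, (0 : ℝ) ≤ p i := fun i => (p i).2.1
  have hp1 : ∀ i, (p i : ℝ) ≤ 1 := fun i => (p i).2.2
  have hW0 : ∀ s, 0 ≤ W s := fun s => weight_nonneg hp0 hp1 s
  have hmeas : ∀ T : Set (Set ι), MeasurableSet T := fun T => MeasurableSet.of_discrete
  -- total mass and marginals
  have hW1 : ∑ s, W s = 1 := by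
    have h := prodBernoulli_real_eq_sum_weight_ind p (Set.univ : Set (Set ι))
    rw [probReal_univ] at h
    rw [h]
    exact Finset.sum_congr rfl fun s _ => by rw [ind_of_mem (Set.mem_univ s), mul_one]
  have hW2 : ∀ i, ∑ s, W s * ind {s' : Set ι | i ∈ s'} s = p i := by
    intro i
    rw [← prodBernoulli_real_eq_sum_weight_ind p {s' : Set ι | i ∈ s'}, prodBernoulli_real_setOf_mem]
  have hmeanX : ∑ s, W s * ((c + (univ.filter (fun i => i ∈ s)).card : ℕ) : ℝ) = S := by
    have hcast : ∀ s : Set ι, ((c + (univ.filter (fun i => i ∈ s)).card : ℕ) : ℝ) =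
        (c : ℝ) + ∑ i, (1 : ℝ) * ind {s' : Set ι | i ∈ s'} s := by
      intro s
      have h := mass_cast_eq_sum_ind (fun _ : ι => (1 : ℕ)) s
      simp only [Finset.sum_const, smul_eq_mul, mul_one, Nat.cast_one] at h
      push_cast
      rw [← h]
    simp_rw [hcast, mul_add, Finset.sum_add_distrib, ← Finset.sum_mul, hW1, one_mul]
    rw [hS]
    congr 1
    simp_rw [Finset.mul_sum]
    rw [Finset.sum_comm]
    exact Finset.sum_congr rfl fun i _ => hW2 i
  -- integrate the three-window bound: `S ≤ k P(E1) + j P(E2) + M P(E3)`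
  have hint : S ≤ k * μ.real E1 + j * μ.real E2 + ((c : ℝ) + Fintype.card ι) * μ.real E3 := by
    rw [← hmeanX, prodBernoulli_real_eq_sum_weight_ind p E1, prodBernoulli_real_eq_sum_weight_ind p E2,
      prodBernoulli_real_eq_sum_weight_ind p E3, Finset.mul_sum, Finset.mul_sum, Finset.mul_sum,
      ← Finset.sum_add_distrib, ← Finset.sum_add_distrib]
    refine Finset.sum_le_sum fun s _ => ?_
    have h := count_le_threeWindow_bound (ι := ι) c k j s
    have hWs := hW0 s
    calc W s * ((c + (univ.filter (fun i => i ∈ s)).card : ℕ) : ℝ)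
        ≤ W s * ((k : ℝ) * ind E1 s + (j : ℝ) * ind E2 s + ((c : ℝ) + Fintype.card ι) * ind E3 s) :=
          mul_le_mul_of_nonneg_left h hWs
      _ = k * (W s * ind E1 s) + j * (W s * ind E2 s) + ((c : ℝ) + Fintype.card ι) * (W s * ind E3 s) := by ring
  -- the atom beats the tail: `P(E1) ≤ P(X ≤ k) ≤ P(X = k+1) ≤ P(E2)`
  have hE1E2 : μ.real E1 ≤ μ.real E2 := by
    by_cases hkc : k < c
    · -- `X ≥ c > k`: `E1` is empty
      have : E1 = ∅ := by
        rw [Set.eq_empty_iff_forall_notMem]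
        intro s hs
        have := hs.2; omega
      rw [this, measureReal_empty]; exact measureReal_nonneg
    · push Not at hkc
      -- leaves count `≤ k − c` versus `= k + 1 − c`
      have hsub1 : E1 ⊆ {s : Set ι | ((univ : Finset ι).filter fun i => i ∈ s).card ≤ k - c} := by
        intro s hs; have := hs.2; show (univ.filter fun i => i ∈ s).card ≤ k - c; omega
      have hsub2 : {s : Set ι | ((univ : Finset ι).filter fun i => i ∈ s).card = k - c + 1} ⊆ E2 := by
        intro s hs
        have h' : (univ.filter fun i => i ∈ s).card = k - c + 1 := hs
        refine ⟨?_, ?_⟩ <;> omega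
      have hU : (2 * ((k - c : ℕ) : ℝ)) + 1 ≤ ∑ i ∈ (univ : Finset ι), (p i : ℝ) := by
        have : ((k - c : ℕ) : ℝ) = (k : ℝ) - c := by push_cast [Nat.cast_sub hkc]; ring
        rw [this]
        have hk' : ((k : ℕ) : ℝ) = (j : ℝ) - a := by rw [hk]; push_cast [Nat.cast_sub haj]; ring
        have hc0 : (0 : ℝ) ≤ c := Nat.cast_nonneg c
        linarith
      calc μ.real E1 ≤ μ.real {s : Set ι | ((univ : Finset ι).filter fun i => i ∈ s).card ≤ k - c} :=
            measureReal_mono hsub1 (measure_ne_top _ _)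
        _ ≤ μ.real {s : Set ι | ((univ : Finset ι).filter fun i => i ∈ s).card = k - c + 1} :=
            pb_tail_le_atom p univ (k - c) hU
        _ ≤ μ.real E2 := measureReal_mono hsub2 (measure_ne_top _ _)
  -- the star row at level `k+1`: `P(X ≤ k) ≤ 1 − u`, i.e. `u ≤ P(E2) + P(E3)`
  have hstar : u ≤ μ.real E2 + μ.real E3 := by
    have hunion : E2 ∪ E3 = {s : Set ι | k + 1 ≤ c + (univ.filter (fun i => i ∈ s)).card} := by
      ext s; simp only [hE2, hE3, Set.mem_union, Set.mem_setOf_eq]; omega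
    have hdisj : Disjoint E2 E3 := by
      rw [Set.disjoint_left]; intro s h2 h3
      simp only [hE2, hE3, Set.mem_setOf_eq] at h2 h3; omega
    rw [← measureReal_union hdisj (hmeas _), hunion]
    by_cases hkc : k + 1 ≤ c
    · have : {s : Set ι | k + 1 ≤ c + (univ.filter (fun i => i ∈ s)).card} = Set.univ := by
        rw [Set.eq_univ_iff_forall]; intro s; show k + 1 ≤ c + _; omega
      rw [this, probReal_univ]; linarith [hup i₀, hp1 i₀]
    · push Not at hkc
      have hcompl : {s : Set ι | k + 1 ≤ c + (univ.filter (fun i => i ∈ s)).card} =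
          {s : Set ι | ∑ i ∈ univ.filter (fun i => i ∈ s), (1 : ℕ) ≤ k - c}ᶜ := by
        ext s
        simp only [Set.mem_setOf_eq, Set.mem_compl_iff, Finset.sum_const, smul_eq_mul, mul_one]
        omega
      rw [hcompl, probReal_compl_eq_one_sub (hmeas _)]
      have hsb := halfMean_smallBall p (fun _ => (1 : ℕ)) (k - c) (1 - u) (by
        have : ((k - c : ℕ) : ℝ) = (k : ℝ) - c := by push_cast [Nat.cast_sub (by omega : c ≤ k)]; ring
        simp only [Nat.cast_one, one_mul]
        rw [this]
        have hk' : ((k : ℕ) : ℝ) = (j : ℝ) - a := by rw [hk]; push_cast [Nat.cast_sub haj]; ring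
        have hc0 : (0 : ℝ) ≤ c := Nat.cast_nonneg c
        linarith) (fun i => by linarith [hup i])
      linarith
  -- `S/u ≥ c + |ι|`
  have hcard : (c : ℝ) + Fintype.card ι ≤ S / u := by
    rw [le_div_iff₀ hu0]
    have h1 : (Fintype.card ι : ℝ) * u ≤ ∑ i, (p i : ℝ) := by
      calc (Fintype.card ι : ℝ) * u = ∑ _i : ι, u := by rw [Finset.sum_const, Finset.card_univ, nsmul_eq_mul]
        _ ≤ ∑ i, (p i : ℝ) := Finset.sum_le_sum fun i _ => hup i
    have h2 : (c : ℝ) * u ≤ c := by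
      have hu1 : u ≤ 1 := le_trans (hup i₀) (hp1 i₀)
      nlinarith [Nat.cast_nonneg (α := ℝ) c]
    rw [hS]; nlinarith
  -- assemble `V·A + 2j·B ≥ u·V` with `V = S/u + a`, `A = P(E3)`, `B = P(E2)`
  set A := μ.real E3 with hA
  set B := μ.real E2 with hB
  have hA0 : 0 ≤ A := measureReal_nonneg
  have hB0 : 0 ≤ B := measureReal_nonneg
  have hE10 : 0 ≤ μ.real E1 := measureReal_nonneg
  have ha0 : (0 : ℝ) ≤ a := Nat.cast_nonneg a
  have hkR : (k : ℝ) = (j : ℝ) - a := by rw [hk]; push_cast [Nat.cast_sub haj]; ring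
  have hV : u * (S / u + a) ≤ (S / u + a) * A + 2 * j * B := by
    -- from `hint`: `S ≤ k P(E1) + j B + M A ≤ k B + j B + (S/u) A`, and `a u ≤ a (A + B)` (star row)
    have h1 : S ≤ k * B + j * B + S / u * A := by
      have := mul_le_mul_of_nonneg_left hE1E2 (Nat.cast_nonneg k)
      nlinarith [hint, this, hcard, hA0]
    have h2 : u * (S / u + a) = S + a * u := by field_simp
    rw [h2, hkR] at *
    nlinarith [h1, hstar, ha0]
  have hS0 : 0 ≤ S := by
    have h1 : 0 ≤ ∑ i, (p i : ℝ) := Finset.sum_nonneg fun i _ => hp0 i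
    have h2 : (0 : ℝ) ≤ c := Nat.cast_nonneg c
    rw [hS]; linarith
  have hSu : 0 ≤ S / u := div_nonneg hS0 hu0.le
  have hVpos : 0 < S / u + a := by
    have : (1 : ℝ) ≤ a := by exact_mod_cast ha1
    linarith
  have hgV : 2 * j ≤ g * (S / u + a) := by
    have : g / u * S + a * g = g * (S / u + a) := by ring
    linarith [hmean, this]
  have key : u * (S / u + a) ≤ (S / u + a) * (A + g * B) := by
    have : (S / u + a) * (A + g * B) = (S / u + a) * A + g * (S / u + a) * B := by ring
    rw [this]
    nlinarith [hV, hgV, hB0]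
  have := le_of_mul_le_mul_right (by linarith [key] : u * (S / u + a) ≤ (A + g * B) * (S / u + a)) hVpos
  linarith [this]

/-- **Tree form of the light-block inequality (both tie cells).**  Hub gate `0 < G ≤ 1`, block gate `0 < g ≤ 1`, block size `1 ≤ a ≤ j`,
leaves with conditional gates `p i ≥ p i₀`; `X = c + #{open leaves}`, `A = P(X ≥ j+1)`, `B = P(j+1−a ≤ X ≤ j)`.  Under the FAR mean hypothesis
at layer `j` for the tree "hub (`c` glued relays + leaves) + root block of `a` relays", `2j < G·(c + Σ p_i) + a·g`, one has
`G·(A + g·B) ≥ min(g, G·p i₀)` — the least marginal.  (`2(j−a)+1 ≤ c + Σ p_i` follows from the mean hypothesis since `G, g ≤ 1`.) [this work] -/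
theorem twoLevel_lightBlock_tree (p : ι → unitInterval) (c j a : ℕ) (G g : ℝ) (hG0 : 0 < G) (hG1 : G ≤ 1)
    (hg0 : 0 < g) (hg1 : g ≤ 1) (ha1 : 1 ≤ a) (haj : a ≤ j)
    (i₀ : ι) (hmin : ∀ i, (p i₀ : ℝ) ≤ p i)
    (hEN : (2 * j : ℝ) < G * ((c : ℝ) + ∑ i, (p i : ℝ)) + a * g) :
    min g (G * p i₀) ≤
      G * ((prodBernoulli p).real {s : Set ι | j + 1 ≤ c + (univ.filter (fun i => i ∈ s)).card} +
        g * (prodBernoulli p).real {s : Set ι | j + 1 - a ≤ c + (univ.filter (fun i => i ∈ s)).card ∧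
          c + (univ.filter (fun i => i ∈ s)).card ≤ j}) := by
  set A := (prodBernoulli p).real {s : Set ι | j + 1 ≤ c + (univ.filter (fun i => i ∈ s)).card} with hA
  set B := (prodBernoulli p).real {s : Set ι | j + 1 - a ≤ c + (univ.filter (fun i => i ∈ s)).card ∧
    c + (univ.filter (fun i => i ∈ s)).card ≤ j} with hB
  set S : ℝ := (c : ℝ) + ∑ i, (p i : ℝ) with hS
  have hA0 : 0 ≤ A := measureReal_nonneg
  have hB0 : 0 ≤ B := measureReal_nonneg
  have hS0 : 0 ≤ S := by
    have : 0 ≤ ∑ i, (p i : ℝ) := Finset.sum_nonneg fun i _ => (p i).2.1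
    rw [hS]; positivity
  have ha0 : (0 : ℝ) ≤ a := Nat.cast_nonneg a
  -- the automatic hypothesis `2k + 1 ≤ S`
  have hCU : (2 * (j - a) : ℝ) + 1 ≤ S := by
    have h1 : G * S ≤ S := by nlinarith
    have h2 : (a : ℝ) * g ≤ a := by nlinarith
    have h3 : (2 * j : ℝ) < S + a := by linarith
    have h4 : ((j - a : ℕ) : ℝ) = (j : ℝ) - a := by push_cast [Nat.cast_sub haj]; ring
    -- `2j < S + a` with integers `j, a` and ... we need `2j − 2a + 1 ≤ S`: from `S > 2j − a ≥ 2j − 2a + 1 − 1`... use `a ≥ 1`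
    have h5 : (1 : ℝ) ≤ a := by exact_mod_cast ha1
    linarith
  by_cases hcase : g ≤ G * p i₀
  · -- the block is least likely: `u = g / G`
    rw [min_eq_left hcase]
    have hu0 : 0 < g / G := div_pos hg0 hG0
    have hup : ∀ i, g / G ≤ (p i : ℝ) := fun i => by
      rw [div_le_iff₀ hG0]; nlinarith [hmin i, hcase]
    have hmean : (2 * j : ℝ) < (g / (g / G)) * S + a * g := by
      have : g / (g / G) = G := by field_simp
      rw [this]; exact hEN
    have h := twoLevel_lightBlock p c j a (g / G) g hu0 hup i₀ ha1 haj hCU hmean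
    rw [← hA, ← hB] at h
    have : G * (g / G) = g := by field_simp
    nlinarith [h, this, hG0.le]
  · -- leaf `i₀` is least likely: `u = p i₀`
    push Not at hcase
    rw [min_eq_right hcase.le]
    by_cases hp0 : (p i₀ : ℝ) = 0
    · rw [hp0, mul_zero]; exact mul_nonneg hG0.le (add_nonneg hA0 (mul_nonneg hg0.le hB0))
    · have hu0 : 0 < (p i₀ : ℝ) := lt_of_le_of_ne (p i₀).2.1 (Ne.symm hp0)
      have hgu : G < g / p i₀ := by rw [lt_div_iff₀ hu0]; linarith
      have hmean : (2 * j : ℝ) < (g / p i₀) * S + a * g := by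
        have : G * S ≤ (g / p i₀) * S := mul_le_mul_of_nonneg_right hgu.le hS0
        linarith
      have h := twoLevel_lightBlock p c j a (p i₀) g hu0 hmin i₀ ha1 haj hCU hmean
      rw [← hA, ← hB] at h
      nlinarith [h, hG0.le]

end Quant

end Summit.CriticalPhenomena.PercolationContinuityZ3.Theorems

end
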